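import Mathlib
import HarnessLib
import Literature.Analysis.FluidPDE.AdaptedBackwardKernel
import Literature.Analysis.FluidPDE.ClassicalSolution
import Literature.Analysis.FluidPDE.LerayHopf
import Literature.Analysis.FluidPDE.VectorCalculus
import Literature.Analysis.FluidPDE.NSWave0

/-!
# Sketch — crux-ideate round 1, ideator 1, crux `AdaptedFrequencyConverges` (stmt-NavierStokesRegularity-10493)

First lemmas of the two idea cards `unsteadiness-squeeze` and `cloud-frame-effective-tsai`,
stated over existing declarations (nothing proved here; the point is that they ELABORATE).

Conventions (blow-up at `(T, x₀)`, similarity time `s = −log (T − t)`, `y = (x − x₀)/√(T−t)`):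
* rescaled vorticity `Ω(s, y) = e^{−s} ω(T − e^{−s}, x₀ + e^{−s/2} y)`, `ω = curl u`;
* rescaled kernel `𝒢(s, y) = e^{−3s/2} G(T − e^{−s}, x₀ + e^{−s/2} y)` (unit mass in `y`);
* vorticity unsteadiness `𝔲(s) = ‖∂ₛΩ(s, ·)‖_{L²(𝒢(s) dy)}`;
* kernel (Fisher) speed `𝔨(s) = ‖∂ₛ log 𝒢(s, ·)‖_{L²(𝒢(s) dy)}`.
-/

noncomputable section

namespace Summit.NavierStokesRegularity.NavierStokesRegularity.Cruxes.AdaptedFrequencyConverges.Ideator1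

open MeasureTheory Set Filter Topology
open Literature.Analysis.FluidPDE

/-- `ℝ³`. -/
abbrev E3 := EuclideanSpace ℝ (Fin 3)

/-- Rescaled (similarity) vorticity about the blow-up point `(T, x₀)`. -/
def rescaledVorticity (u : ℝ → E3 → E3) (T : ℝ) (x₀ : E3) (s : ℝ) (y : E3) : E3 :=
  Real.exp (-s) • curl (u (T - Real.exp (-s))) (x₀ + Real.exp (-s / 2) • y)

/-- Rescaled (similarity) kernel about `(T, x₀)`; a probability density in `y` for each `s`. -/
def rescaledKernel (G : ℝ → E3 → ℝ) (T : ℝ) (x₀ : E3) (s : ℝ) (y : E3) : ℝ :=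
  Real.exp (-(3 : ℝ) * s / 2) * G (T - Real.exp (-s)) (x₀ + Real.exp (-s / 2) • y)

/-- Vorticity unsteadiness `𝔲(s) = ‖∂ₛΩ(s,·)‖_{L²(𝒢(s))}` (zero on backward self-similar flows). -/
def vorticityUnsteadiness (u : ℝ → E3 → E3) (G : ℝ → E3 → ℝ) (T : ℝ) (x₀ : E3) (s : ℝ) : ℝ :=
  Real.sqrt (∫ y, ‖deriv (fun s' => rescaledVorticity u T x₀ s' y) s‖ ^ 2 * rescaledKernel G T x₀ s y)

/-- Rescaled adapted enstrophy `ℋ(s) = e^{−2s} H(T − e^{−s}) = ∫|Ω|²𝒢 dy` (bounded above by Type I,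
below by the floor `c`). -/
def rescaledEnstrophy (u : ℝ → E3 → E3) (G : ℝ → E3 → ℝ) (T : ℝ) (s : ℝ) : ℝ :=
  Real.exp (-2 * s) * adaptedEnstrophy u G (T - Real.exp (-s))

/-- `N(s) = Λ/2 − 1`, the Agmon–Nirenberg quotient of the conjugated vorticity (`N ≡ 0` on backward
self-similar flows). -/
def anQuotient (u : ℝ → E3 → E3) (G : ℝ → E3 → ℝ) (T : ℝ) (s : ℝ) : ℝ :=
  adaptedFrequency u G T (T - Real.exp (-s)) / 2 - 1

/-- **Non-breathing (relative) unsteadiness** `a(s) = ‖∂ₛΩ + (½∂ₛlog𝒢 − N)Ω‖_{L²(𝒢)} / √ℋ`: the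
distance of the conjugated vorticity's velocity from pure instantaneous rescaling. `a = 0` at an
instant iff the enstrophy density `|Ω|²𝒢` changes shape nowhere ("breathing"); `a = 0 = N` iff the
instant is steady. This — not the total unsteadiness — is what the Agmon–Nirenberg gain sees. -/
def relativeUnsteadiness (u : ℝ → E3 → E3) (G : ℝ → E3 → ℝ) (T : ℝ) (x₀ : E3) (s : ℝ) : ℝ :=
  Real.sqrt (∫ y, ‖deriv (fun s' => rescaledVorticity u T x₀ s' y) s +
      ((1 / 2 : ℝ) * deriv (fun s' => Real.log (rescaledKernel G T x₀ s' y)) s - anQuotient u G T s) •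
        rescaledVorticity u T x₀ s y‖ ^ 2 * rescaledKernel G T x₀ s y) /
    Real.sqrt (rescaledEnstrophy u G T s)

/-- Kernel (Fisher) speed `𝔨(s) = ‖∂ₛ log 𝒢(s,·)‖_{L²(𝒢(s))}` (zero iff the cloud is momentarily
stationary in similarity variables). -/
def kernelSpeed (G : ℝ → E3 → ℝ) (T : ℝ) (x₀ : E3) (s : ℝ) : ℝ :=
  Real.sqrt (∫ y, (deriv (fun s' => Real.log (rescaledKernel G T x₀ s' y)) s) ^ 2 *
    rescaledKernel G T x₀ s y)

/-- Common hypothesis block of the crux, with the Type-I constant `C`, the comparability constants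
and a non-degeneracy floor `c ≤ (T−t)² H(t)` made explicit (constants of the lemmas depend on them). -/
def CruxSetting (ν C c c₁ c₂ C₁ C₂ T t₀ : ℝ) (u : ℝ → E3 → E3) (p : ℝ → E3 → ℝ) (x₀ : E3)
    (G : ℝ → E3 → ℝ) : Prop :=
  t₀ ∈ Ico 0 T ∧ IsClassicalNSSolutionOn (Ico 0 T) ν 0 u p ∧ IsLerayHopfOn T ν 0 (u 0) u ∧
    HasRapidSpatialDecay (u 0) ∧ (∀ t ∈ Ico t₀ T, ∀ x, ‖u t x‖ ≤ C / Real.sqrt (T - t)) ∧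
    IsAdaptedBackwardKernel ν u (Ico t₀ T) T x₀ G ∧
    (∀ t ∈ Ico t₀ T, ∀ x,
      c₁ * (T - t) ^ (-(3 : ℝ) / 2) * Real.exp (-(‖x - x₀‖ ^ 2) / (c₂ * (T - t))) ≤ G t x ∧
        G t x ≤ C₁ * (T - t) ^ (-(3 : ℝ) / 2) * Real.exp (-(‖x - x₀‖ ^ 2) / (C₂ * (T - t)))) ∧
    (∀ t ∈ Ico t₀ T, c ≤ (T - t) ^ 2 * adaptedEnstrophy u G t)

/-! ### Card `unsteadiness-squeeze` — first lemma (upper jaw)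

Agmon–Nirenberg for the adapted frequency in the conjugated frame `L²(𝒢₀)` gives
`N′ = [2‖v′ − N v‖² + ⟨𝓢′v, v⟩ − 2 Re⟨𝒦 v, v′⟩] / ‖v‖²` (`N = Λ/2 − 1`): the GAIN is quadratic in the
unsteadiness, the DEFECT linear. Integrated form, constants depending only on the setting: -/

/-- **Convexity away from breathing (integrated Agmon–Nirenberg identity).** Along a Type-I blow-up
with adapted comparable kernel and enstrophy floor, the adapted frequency increment over `[s₁, s₂]`
is at least `∫ (4 a² − K₁ a − K₂) ds`, `a` the non-breathing unsteadiness: the GAIN coefficient `4`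
is universal (exact identity), the DEFECT is linear in `a` with constants of the setting. Hence
`Λ` is non-decreasing across any interval on which `a ≥ a₀ := (K₁ + √(K₁² + 16 K₂))/8`, and
semi-convex (`Λ′ ≥ −K₂`) everywhere. (On the Disproof's infinite-energy witness `a ≡ 0` and
`Λ = 2 cos s`: pure breathing, zero gain — consistent.) -/
def ConvexityFarFromSteady : Prop :=
  ∀ ν C c c₁ c₂ C₁ C₂ : ℝ, 0 < ν → 0 ≤ C → 0 < c → 0 < c₁ → 0 < c₂ → 0 < C₁ → 0 < C₂ →
    ∃ K₁ K₂ : ℝ, 0 ≤ K₁ ∧ 0 ≤ K₂ ∧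
      ∀ (T t₀ : ℝ) (u : ℝ → E3 → E3) (p : ℝ → E3 → ℝ) (x₀ : E3) (G : ℝ → E3 → ℝ),
        CruxSetting ν C c c₁ c₂ C₁ C₂ T t₀ u p x₀ G →
          ∀ s₁ s₂ : ℝ, -Real.log (T - t₀) + 1 ≤ s₁ → s₁ ≤ s₂ →
            (∫ s in s₁..s₂, (4 * relativeUnsteadiness u G T x₀ s ^ 2
                - K₁ * relativeUnsteadiness u G T x₀ s - K₂)) ≤
              adaptedFrequency u G T (T - Real.exp (-s₂)) -
                adaptedFrequency u G T (T - Real.exp (-s₁))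

/-! ### Card `cloud-frame-effective-tsai` — first lemmas (kernel side)

(1) Harris ergodicity of the rescaled backward particle (Ornstein–Uhlenbeck drift `−y/2` plus the
bounded Type-I drift): the Gaussian-comparable adapted kernel with pole at a Type-I point is UNIQUE.
(2) Bernoulli head paired with the cloud: `ν ℋ + 𝔅′ = −Cov_𝒢(P, ∂ₛ log 𝒢)`, whence the cloud is
never stationary on windows of an explicit length (effective Tsai). -/

/-- **Uniqueness of the adapted kernel at a Type-I pole** (linear statement: any smooth
divergence-free drift with the Type-I time bound). -/
def KernelUniqueness : Prop :=
  ∀ (ν T t₀ C : ℝ), 0 < ν → t₀ < T →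
    ∀ (b : ℝ → E3 → E3), ContDiffOn ℝ 2 (Function.uncurry b) (Ico t₀ T ×ˢ univ) →
      (∀ t ∈ Ico t₀ T, VectorCalculus.IsDivFree (b t)) →
      (∀ t ∈ Ico t₀ T, ∀ x, ‖b t x‖ ≤ C / Real.sqrt (T - t)) →
        ∀ (x₀ : E3) (G₁ G₂ : ℝ → E3 → ℝ),
          IsAdaptedBackwardKernel ν b (Ico t₀ T) T x₀ G₁ → IsGaussianComparable G₁ (Ico t₀ T) T x₀ →
          IsAdaptedBackwardKernel ν b (Ico t₀ T) T x₀ G₂ → IsGaussianComparable G₂ (Ico t₀ T) T x₀ →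
            ∀ t ∈ Ico t₀ T, G₁ t = G₂ t

/-- **Effective non-self-similarity at every scale** (lower jaw): the kernel's Fisher speed in
similarity variables has mean at least `ε` on every log-time window of length `L`, with `ε, L`
depending only on the setting. -/
def EffectiveNonSteadiness : Prop :=
  ∀ ν C c c₁ c₂ C₁ C₂ : ℝ, 0 < ν → 0 ≤ C → 0 < c → 0 < c₁ → 0 < c₂ → 0 < C₁ → 0 < C₂ →
    ∃ ε L : ℝ, 0 < ε ∧ 0 < L ∧
      ∀ (T t₀ : ℝ) (u : ℝ → E3 → E3) (p : ℝ → E3 → ℝ) (x₀ : E3) (G : ℝ → E3 → ℝ),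
        CruxSetting ν C c c₁ c₂ C₁ C₂ T t₀ u p x₀ G →
          ∀ s : ℝ, -Real.log (T - t₀) + 1 ≤ s →
            ε * L ≤ ∫ s' in s..(s + L), kernelSpeed G T x₀ s'

/-- The crux decl of the route, restated by name to record what the cards aim at (sanity: the
three `Prop`s above are OVER the same data). -/
example : Prop := ConvexityFarFromSteady ∧ KernelUniqueness ∧ EffectiveNonSteadiness

end Summit.NavierStokesRegularity.NavierStokesRegularity.Cruxes.AdaptedFrequencyConverges.Ideator1

end
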